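import Summits.RiemannHypothesis.RiemannHypothesis.Theorems.SemilocalNegCertFortyThreeKinked1931
import HarnessLib

/-!
# Semi-local threshold of the `{∞,2,…,43}` form, negative side: `a*({2,…,43}) ≤ 1977 / 1024 = 1.9306640625` — the wall `q = 47` from a KINKED (piecewise-cubic) witness with slope breaks at the prime-atom images (part 16/19: the kernel facts piece 216 … piece 229 of 244 (imports part 1 only))

Cell `rh-explicit` (HOME `run/shared/lean/pub/rh-explicit/`), seat cc-s2-9 gen2 (HUMAN RULING D-0074 (D5) WEIL data engine; LADDER-RH column WEIL, rung DATA → W-P(P2);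
pipeline = cc-s2-4 gen8/gen11's piecewise-witness layer `SemilocalPiecewise{Witness,Increment,IncrementSum,Cert}.lean` + their float finder, every number
re-derived by an independent second engine E2 before filing; gen0's rows: `SemilocalNegCert{ThirteenKinked1423,SeventeenKinked1478,NineteenKinked1573,TwentyThreeKinked1690,TwentyNineKinked1723}*`).
HONEST FRAMING: RH-FREE theorems about the tree's `weilSemilocalThreshold S` of a TRUNCATED Weil form (finitely many places); nothing here bears on the
truth of RH; the lower clause `(log q)/2 ≤ a*(S_q)` at all primes IS RH and is untouched; the SIGN of `δ*(47)` is not claimed.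

KINKED row for the wall `q = 47` (`S = {2,…,43}`): at `b = 1977 / 1024 = 1.9306640625 ≈ a*(S_47) + 0.0055` (DATA, two engines, cc-s2-6/cc-s2-3: `a*(S_47) = 1.925125`)
the polynomial × indicator class is far from negative (tree row `499/256`, `SemilocalNegCertUptoFortyThree`, `δ*(47) ≤ 0.0241`), whereas an odd piecewise cubic with slope breaks at the images
`|b − log n|` (rounded to `/1024`) of the atoms `n ∈ {2,3,5,7,11,13,17,19,23,29,31,37,41,43}` (the fourteen PRIME atoms; images of 4, 8, 9, 16, 25, 27, 32 dropped — all twenty-one kinks: λ_min = −1.37·10⁻², primes + 4 + 9: −5.59·10⁻³; kit j253132) is negative by `4.289e-03·‖G‖²`.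
Instance: `S = {2, 3, 5, 7, 11, 13, 17, 19, 23, 29, 31, 37, 41, 43}`, `N = 47` (atom table `atomsUptoFortyThreeN47` / `atomsEnclose_UptoFortyThreeN47` of THIS file: the tree's `atomsUptoFortyThree` (`N = 49`, `SemilocalNegCertUptoFortyThree.lean`) minus the atom `49`, whose image lies above `2b = 1977/512 < log 48`), 15 pieces of degree ≤ 3, 244 `t`-pieces;
TWO ENGINES on the witness before the kernel: cc-s2-4's float finder `λ_min = -4.2886e-03` and the seat's exact-in-`x` decimal engine E2 `R = -4.2860e-03` (no polar credit);
the exact kernel margin is the certificate's own rational arithmetic (farm report).  ⇒ **`a*({2,…,43}) ≤ 1977 / 1024`, `δ*(47) < 0.005591`** (was `0.0241`).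
No data is trusted: every bound is a `decide +kernel` fact.  Folklore throughout.
-/

set_option autoImplicit false
set_option linter.dupNamespace false  -- the mandated namespace repeats `RiemannHypothesis`
set_option Elab.async false  -- serialise the kernel facts: in parallel they exhaust the node's per-process heap (cc-s2-4 gen11, CC4-LEAN §16.10)

noncomputable section

open Complex Filter Set MeasureTheory Topology
open scoped Real

namespace Summit.RiemannHypothesis.RiemannHypothesis.Theorems.SemilocalPolyWitness

open MeasureTheory Set Finset Real
open Literature.NumberTheory.LFunctions
open Summit.RiemannHypothesis.RiemannHypothesis.Theorems.MotivicDoor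
open Summit.RiemannHypothesis.RiemannHypothesis.Theorems.MotivicDoor.SemilocalThreshold
open Summit.RiemannHypothesis.RiemannHypothesis.Theorems.MotivicDoor.SemilocalMarkov
open LQ

set_option maxHeartbeats 0 in
/-- kernel fact: piece `216` of `certFortyThreeKinked1931`. -/
theorem check_FortyThreeKinked1931_piece216 : certFortyThreeKinked1931.checkPiecePW 216 = true := by
  decide +kernel

set_option maxHeartbeats 0 in
/-- kernel fact: piece `217` of `certFortyThreeKinked1931`. -/
theorem check_FortyThreeKinked1931_piece217 : certFortyThreeKinked1931.checkPiecePW 217 = true := by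
  decide +kernel

set_option maxHeartbeats 0 in
/-- kernel fact: piece `218` of `certFortyThreeKinked1931`. -/
theorem check_FortyThreeKinked1931_piece218 : certFortyThreeKinked1931.checkPiecePW 218 = true := by
  decide +kernel

set_option maxHeartbeats 0 in
/-- kernel fact: piece `219` of `certFortyThreeKinked1931`. -/
theorem check_FortyThreeKinked1931_piece219 : certFortyThreeKinked1931.checkPiecePW 219 = true := by
  decide +kernel

set_option maxHeartbeats 0 in
/-- kernel fact: piece `220` of `certFortyThreeKinked1931`. -/
theorem check_FortyThreeKinked1931_piece220 : certFortyThreeKinked1931.checkPiecePW 220 = true := by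
  decide +kernel

set_option maxHeartbeats 0 in
/-- kernel fact: piece `221` of `certFortyThreeKinked1931`. -/
theorem check_FortyThreeKinked1931_piece221 : certFortyThreeKinked1931.checkPiecePW 221 = true := by
  decide +kernel

set_option maxHeartbeats 0 in
/-- kernel fact: piece `222` of `certFortyThreeKinked1931`. -/
theorem check_FortyThreeKinked1931_piece222 : certFortyThreeKinked1931.checkPiecePW 222 = true := by
  decide +kernel

set_option maxHeartbeats 0 in
/-- kernel fact: piece `223` of `certFortyThreeKinked1931`. -/
theorem check_FortyThreeKinked1931_piece223 : certFortyThreeKinked1931.checkPiecePW 223 = true := by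
  decide +kernel

set_option maxHeartbeats 0 in
/-- kernel fact: piece `224` of `certFortyThreeKinked1931`. -/
theorem check_FortyThreeKinked1931_piece224 : certFortyThreeKinked1931.checkPiecePW 224 = true := by
  decide +kernel

set_option maxHeartbeats 0 in
/-- kernel fact: piece `225` of `certFortyThreeKinked1931`. -/
theorem check_FortyThreeKinked1931_piece225 : certFortyThreeKinked1931.checkPiecePW 225 = true := by
  decide +kernel

set_option maxHeartbeats 0 in
/-- kernel fact: piece `226` of `certFortyThreeKinked1931`. -/
theorem check_FortyThreeKinked1931_piece226 : certFortyThreeKinked1931.checkPiecePW 226 = true := by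
  decide +kernel

set_option maxHeartbeats 0 in
/-- kernel fact: piece `227` of `certFortyThreeKinked1931`. -/
theorem check_FortyThreeKinked1931_piece227 : certFortyThreeKinked1931.checkPiecePW 227 = true := by
  decide +kernel

set_option maxHeartbeats 0 in
/-- kernel fact: piece `228` of `certFortyThreeKinked1931`. -/
theorem check_FortyThreeKinked1931_piece228 : certFortyThreeKinked1931.checkPiecePW 228 = true := by
  decide +kernel

set_option maxHeartbeats 0 in
/-- kernel fact: piece `229` of `certFortyThreeKinked1931`. -/
theorem check_FortyThreeKinked1931_piece229 : certFortyThreeKinked1931.checkPiecePW 229 = true := by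
  decide +kernel

end Summit.RiemannHypothesis.RiemannHypothesis.Theorems.SemilocalPolyWitness

end
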